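import Literature.Analysis.Matrix.LogDetMixedDifferenceLocallySummed
import HarnessLib

/-!
# The mixed second difference of `log det`, IV: the LOCAL-IN-`s` editions (hypotheses on the parameter interval `[0,1]` only)

Topic `Literature/Analysis/Matrix`; namespace `Literature.Analysis.Matrix`.  Sequel of `LogDetMixedDifference.lean`, `LogDetMixedDifferenceExpLocalised.lean`
and `LogDetMixedDifferenceLocallySummed.lean`.  Everything here is PROVED; no definitions, no named facts.

THE POINT.  The rectangle theorems of the three prequels ask the matrix families `s ↦ M(s,t)` to be C¹ and invertible for ALL real `s`, although only the
segment `s ∈ [0,1]` (the interpolation between two values of one bond variable) is ever integrated over.  In the application the matrices are Hessians of an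
action at a MOVING MINIMISER, which exists only near the interpolation path; a global-in-`s` family would need an artificial re-parametrisation.  This
file re-proves the FTC step and the card-free rectangle with every hypothesis restricted to `s ∈ [0,1]`:
* §1 ★`log_det_sub_eq_integral_trace_Icc` — `log det M(1) − log det M(0) = ∫₀¹ tr(M(s)⁻¹ M′(s)) ds` for a family continuous on `[0,1]` entrywise,
  differentiable on `(0,1)` with a derivative `M′` continuous on `[0,1]`, and invertible on `[0,1]`.
* §2 ★★`abs_fourPt_log_det_le_of_summedProfiles_Icc` — `abs_fourPt_log_det_le_of_summedProfiles` with `hM hM'c hne hD hE hA hB0 hR` asked only for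
  `s ∈ [0,1]` (derivatives on `(0,1)`): `|Δ² log det| ≤ α·ε·β₀·δ·S_d·S_dist·e^{−(θ−θ₂)R} + β₀·η`.
* §3 ★`abs_fourPt_log_det_le_of_productRows_Icc` — the same in PRODUCT FORM (`α·ε·β₀·δ·S_d·S_dist ≤ B`, `β₀·η ≤ B·e^{−(θ−θ₂)R}` ⟹ `≤ 2·B·e^{−(θ−θ₂)R}`).
* §4 ★`abs_fourPt_log_det_le_of_productRows_of_subset` — docking edition: differentiability∕continuity-of-derivative∕invertibility rows on ANY set `I ⊇ [0,1]`
  (e.g. an open neighbourhood of the path, the shape in which a moving-minimiser Hessian family comes), localisation rows on `[0,1]`.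

Consumer (cell `ym3-torus`, crux `FluctuationComparisonRegPrIntL`, LINE «semiclassical S2β» v11 DET-REP-A∕B): the (DET) rows in LOCAL form (w5-20520 g14
21:41:19Z «(DET) global vs `Icc`?»).  HONEST SCOPE: finite-dimensional linear algebra + one FTC on `[0,1]`; nothing here bears on the Yang–Mills mass gap (Clay), which
is NOT proved.

References: T. Bałaban, CMP 102 (1985) 277, Thm 1 (9)–(10) p. 279 [Balaban1985Variational]; J. Glimm, A. Jaffe, *Quantum Physics* (1987) §18.2 [GlimmJaffe1987];
R. A. Horn, C. R. Johnson, *Matrix Analysis* (2013) §0.8.10 [HornJohnson2013].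
-/

noncomputable section

open Matrix Finset MeasureTheory intervalIntegral Set
open scoped Matrix Topology

namespace Literature.Analysis.Matrix

variable {n : Type*} [Fintype n] [DecidableEq n]

/-! ## §1 FTC for `log det` along a path that is C¹ on `[0,1]` only -/

/-- ★ **Jacobi's formula integrated over `[0,1]`, LOCAL hypotheses**: if every entry `s ↦ M(s) i j` is continuous on `[0,1]` and has derivative `M′(s) i j` at
every `s ∈ (0,1)`, every `s ↦ M′(s) i j` is continuous on `[0,1]`, and `det M(s) ≠ 0` on `[0,1]`, then
`log det M(1) − log det M(0) = ∫₀¹ tr(M(s)⁻¹ M′(s)) ds`. [cite: HornJohnson2013, §0.8.10 (Jacobi's formula)] -/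
theorem log_det_sub_eq_integral_trace_Icc {M M' : ℝ → Matrix n n ℝ}
    (hMc : ∀ i j, ContinuousOn (fun s => M s i j) (Icc 0 1))
    (hM : ∀ s ∈ Ioo (0 : ℝ) 1, ∀ i j, HasDerivAt (fun s => M s i j) (M' s i j) s)
    (hM'c : ∀ i j, ContinuousOn (fun s => M' s i j) (Icc 0 1))
    (hne : ∀ s ∈ Icc (0 : ℝ) 1, (M s).det ≠ 0) :
    Real.log (M 1).det - Real.log (M 0).det = ∫ s in (0 : ℝ)..1, ((M s)⁻¹ * M' s).trace := by
  -- continuity of `M`, `M⁻¹`, `M′` and the integrand on `[0,1]`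
  have hMco : ContinuousOn M (Icc 0 1) := continuousOn_pi.2 fun i => continuousOn_pi.2 fun j => hMc i j
  have hM'co : ContinuousOn M' (Icc 0 1) := continuousOn_pi.2 fun i => continuousOn_pi.2 fun j => hM'c i j
  have hinv : ContinuousOn (fun s => (M s)⁻¹) (Icc 0 1) := by
    intro s hs
    have h : ContinuousAt Ring.inverse (M s).det := by
      rw [Ring.inverse_eq_inv']
      exact continuousAt_inv₀ (hne s hs)
    exact ContinuousAt.comp_continuousWithinAt (f := M) (g := fun A : Matrix n n ℝ => A⁻¹) (continuousAt_matrix_inv (M s) h) (hMco s hs)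
  have htr : ContinuousOn (fun s => ((M s)⁻¹ * M' s).trace) (Icc 0 1) :=
    (continuous_id.matrix_trace.comp_continuousOn (hinv.mul hM'co) :)
  -- continuity of `log det M` on `[0,1]`
  have hlog : ContinuousOn (fun s => Real.log (M s).det) (Icc 0 1) := by
    intro s hs
    have hdet : ContinuousWithinAt (fun s => (M s).det) (Icc 0 1) s :=
      ((continuous_id.matrix_det).continuousAt).comp_continuousWithinAt (hMco s hs)
    exact ContinuousAt.comp_continuousWithinAt (g := Real.log) (f := fun s => (M s).det) (Real.continuousAt_log (hne s hs)) hdet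
  -- the derivative on `(0,1)`
  have hderiv : ∀ s ∈ Ioo (0 : ℝ) 1, HasDerivAt (fun s => Real.log (M s).det) (((M s)⁻¹ * M' s).trace) s :=
    fun s hs => LogDetDerivative.hasDerivAt_real_log_det (hM s hs) (hne s (Ioo_subset_Icc_self hs))
  have hint : IntervalIntegrable (fun s => ((M s)⁻¹ * M' s).trace) volume 0 1 :=
    ContinuousOn.intervalIntegrable (by rwa [Set.uIcc_of_le (zero_le_one : (0 : ℝ) ≤ 1)])
  rw [integral_eq_sub_of_hasDerivAt_of_le zero_le_one hlog hderiv hint]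

/-! ## §2 The card-free rectangle with hypotheses on `[0,1]` only -/

/-- ★★ **`Δ² log det` OVER A RECTANGLE, LOCALLY SUMMED VARIATIONS, LOCAL-IN-`s` HYPOTHESES.**  As `abs_fourPt_log_det_le_of_summedProfiles`, but the family
`M(s,t)` (`t = 0, 1`) is asked to be entrywise continuous on `s ∈ [0,1]`, differentiable on `(0,1)` with a derivative `M′(s,t)` continuous on `[0,1]`, invertible
on `[0,1]`, and the rows `hD hE hA hB0 hR` are asked for `s ∈ [0,1]` only.  Conclusion unchanged:
`|log det M(0,0) − log det M(1,0) − (log det M(0,1) − log det M(1,1))| ≤ α·ε·β₀·δ·S_d·S_dist·e^{−(θ−θ₂)·R} + β₀·η`.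
[cite: Balaban1985Variational, Thm 1 (10) p. 279] [cite: GlimmJaffe1987, §18.2] -/
theorem abs_fourPt_log_det_le_of_summedProfiles_Icc (dist : n → n → ℕ) {M M' : ℝ → ℝ → Matrix n n ℝ}
    (hMc : ∀ t i j, ContinuousOn (fun s => M s t i j) (Icc 0 1))
    (hM : ∀ t, ∀ s ∈ Ioo (0 : ℝ) 1, ∀ i j, HasDerivAt (fun s => M s t i j) (M' s t i j) s)
    (hM'c : ∀ t i j, ContinuousOn (fun s => M' s t i j) (Icc 0 1))
    (hne : ∀ s ∈ Icc (0 : ℝ) 1, ∀ t, (M s t).det ≠ 0)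
    {α ε δ β₀ η θ θ₂ Sd Sdist : ℝ} (hα : 0 ≤ α) (hε : 0 ≤ ε) (hδ : 0 ≤ δ) (hβ₀ : 0 ≤ β₀)
    (hθ₂ : 0 ≤ θ₂) (hθ₂θ : θ₂ ≤ θ) (hSdist0 : 0 ≤ Sdist)
    {d d' : n → ℕ} (hD : ∀ s ∈ Icc (0 : ℝ) 1, ∀ a, ∑ x, |M' s 1 x a| ≤ δ * Real.exp (-(θ * d a)))
    (hE : ∀ s ∈ Icc (0 : ℝ) 1, ∀ b, ∑ c, |(M s 1 - M s 0) b c| ≤ ε * Real.exp (-(θ * d' b)))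
    {R : ℕ} (hsep : ∀ a b, R ≤ d a + dist a b + d' b)
    (hA : ∀ s ∈ Icc (0 : ℝ) 1, ∀ a b, |(M s 1)⁻¹ a b| ≤ α * Real.exp (-(θ * dist a b)))
    (hB0 : ∀ s ∈ Icc (0 : ℝ) 1, ∀ a b, |(M s 0)⁻¹ a b| ≤ β₀)
    (hSd : ∑ a, Real.exp (-(θ₂ * d a)) ≤ Sd) (hSdi : ∀ a, ∑ b, Real.exp (-(θ₂ * dist a b)) ≤ Sdist)
    (hR : ∀ s ∈ Icc (0 : ℝ) 1, ∑ a, ∑ b, |(M' s 1 - M' s 0) a b| ≤ η) :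
    |Real.log (M 0 0).det - Real.log (M 1 0).det - (Real.log (M 0 1).det - Real.log (M 1 1).det)|
      ≤ α * ε * β₀ * δ * Sd * Sdist * Real.exp (-((θ - θ₂) * R)) + β₀ * η := by
  have h1 := log_det_sub_eq_integral_trace_Icc (M := fun s => M s 1) (M' := fun s => M' s 1) (hMc 1) (hM 1) (hM'c 1)
    (fun s hs => hne s hs 1)
  have h0 := log_det_sub_eq_integral_trace_Icc (M := fun s => M s 0) (M' := fun s => M' s 0) (hMc 0) (hM 0) (hM'c 0)
    (fun s hs => hne s hs 0)
  -- continuity of the two integrands on `[0,1]` (for integrability)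
  have hcont : ∀ t, ContinuousOn (fun s => ((M s t)⁻¹ * M' s t).trace) (Icc 0 1) := by
    intro t
    have hMco : ContinuousOn (fun s => M s t) (Icc 0 1) := continuousOn_pi.2 fun i => continuousOn_pi.2 fun j => hMc t i j
    have hM'co : ContinuousOn (fun s => M' s t) (Icc 0 1) := continuousOn_pi.2 fun i => continuousOn_pi.2 fun j => hM'c t i j
    have hinv : ContinuousOn (fun s => (M s t)⁻¹) (Icc 0 1) := by
      intro s hs
      have h : ContinuousAt Ring.inverse (M s t).det := by
        rw [Ring.inverse_eq_inv']
        exact continuousAt_inv₀ (hne s hs t)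
      exact ContinuousAt.comp_continuousWithinAt (f := fun s => M s t) (g := fun A : Matrix n n ℝ => A⁻¹)
        (continuousAt_matrix_inv (M s t) h) (hMco s hs)
    exact (continuous_id.matrix_trace.comp_continuousOn (hinv.mul hM'co) :)
  have hint : ∀ t, IntervalIntegrable (fun s => ((M s t)⁻¹ * M' s t).trace) volume 0 1 := fun t =>
    ContinuousOn.intervalIntegrable (by rw [Set.uIcc_of_le (zero_le_one : (0 : ℝ) ≤ 1)]; exact hcont t)
  have hrw : Real.log (M 0 0).det - Real.log (M 1 0).det - (Real.log (M 0 1).det - Real.log (M 1 1).det) =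
      ∫ s in (0 : ℝ)..1, (((M s 1)⁻¹ * M' s 1).trace - ((M s 0)⁻¹ * M' s 0).trace) := by
    rw [intervalIntegral.integral_sub (hint 1) (hint 0)]
    beta_reduce at h1 h0
    linarith
  rw [hrw]
  have hpt : ∀ s ∈ Icc (0 : ℝ) 1, |((M s 1)⁻¹ * M' s 1).trace - ((M s 0)⁻¹ * M' s 0).trace| ≤
      α * ε * β₀ * δ * Sd * Sdist * Real.exp (-((θ - θ₂) * R)) + β₀ * η := by
    intro s hs
    rw [trace_inv_mul_sub_trace_inv_mul (hne s hs 0) (hne s hs 1)]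
    refine (abs_add_le _ _).trans (add_le_add ?_ ?_)
    · rw [abs_neg]
      exact abs_trace_mul4_le_of_summedProfiles dist hα hε hβ₀ hδ hθ₂ hθ₂θ hSdist0 (hA s hs) (hB0 s hs) (hD s hs) (hE s hs) hsep hSd hSdi
    · exact abs_trace_mul_le_of_entry_le_of_sum_le hβ₀ (hB0 s hs) (hR s hs)
  have hbd := intervalIntegral.norm_integral_le_of_norm_le_const (a := (0 : ℝ)) (b := 1)
    (f := fun s => ((M s 1)⁻¹ * M' s 1).trace - ((M s 0)⁻¹ * M' s 0).trace)
    (C := α * ε * β₀ * δ * Sd * Sdist * Real.exp (-((θ - θ₂) * R)) + β₀ * η)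
    (fun s hs => by
      rw [Real.norm_eq_abs]
      have hs' : s ∈ Icc (0 : ℝ) 1 := by
        rw [Set.uIoc_of_le (zero_le_one : (0 : ℝ) ≤ 1)] at hs
        exact Ioc_subset_Icc_self hs
      exact hpt s hs')
  rw [Real.norm_eq_abs, sub_zero, abs_one, mul_one] at hbd
  exact hbd

/-! ## §3 The product form with hypotheses on `[0,1]` only -/

/-- ★ **THE LOCAL-IN-`s` RECTANGLE IN PRODUCT FORM**: §2's rows + `α·ε·β₀·δ·S_d·S_dist ≤ B` + `β₀·η ≤ B·e^{−(θ−θ₂)R}` ⟹ `|Δ² log det M| ≤ 2·B·e^{−(θ−θ₂)R}`.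
[cite: Balaban1985Variational, Thm 1 (10) p. 279] [cite: GlimmJaffe1987, §18.2] -/
theorem abs_fourPt_log_det_le_of_productRows_Icc (dist : n → n → ℕ) {M M' : ℝ → ℝ → Matrix n n ℝ}
    (hMc : ∀ t i j, ContinuousOn (fun s => M s t i j) (Icc 0 1))
    (hM : ∀ t, ∀ s ∈ Ioo (0 : ℝ) 1, ∀ i j, HasDerivAt (fun s => M s t i j) (M' s t i j) s)
    (hM'c : ∀ t i j, ContinuousOn (fun s => M' s t i j) (Icc 0 1))
    (hne : ∀ s ∈ Icc (0 : ℝ) 1, ∀ t, (M s t).det ≠ 0)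
    {α ε δ β₀ η θ θ₂ Sd Sdist B : ℝ} (hα : 0 ≤ α) (hε : 0 ≤ ε) (hδ : 0 ≤ δ) (hβ₀ : 0 ≤ β₀)
    (hθ₂ : 0 ≤ θ₂) (hθ₂θ : θ₂ ≤ θ) (hSdist0 : 0 ≤ Sdist)
    {d d' : n → ℕ} (hD : ∀ s ∈ Icc (0 : ℝ) 1, ∀ a, ∑ x, |M' s 1 x a| ≤ δ * Real.exp (-(θ * d a)))
    (hE : ∀ s ∈ Icc (0 : ℝ) 1, ∀ b, ∑ c, |(M s 1 - M s 0) b c| ≤ ε * Real.exp (-(θ * d' b)))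
    {R : ℕ} (hsep : ∀ a b, R ≤ d a + dist a b + d' b)
    (hA : ∀ s ∈ Icc (0 : ℝ) 1, ∀ a b, |(M s 1)⁻¹ a b| ≤ α * Real.exp (-(θ * dist a b)))
    (hB0 : ∀ s ∈ Icc (0 : ℝ) 1, ∀ a b, |(M s 0)⁻¹ a b| ≤ β₀)
    (hSd : ∑ a, Real.exp (-(θ₂ * d a)) ≤ Sd) (hSdi : ∀ a, ∑ b, Real.exp (-(θ₂ * dist a b)) ≤ Sdist)
    (hR : ∀ s ∈ Icc (0 : ℝ) 1, ∑ a, ∑ b, |(M' s 1 - M' s 0) a b| ≤ η)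
    (hprod : α * ε * β₀ * δ * Sd * Sdist ≤ B) (hmix : β₀ * η ≤ B * Real.exp (-((θ - θ₂) * R))) :
    |Real.log (M 0 0).det - Real.log (M 1 0).det - (Real.log (M 0 1).det - Real.log (M 1 1).det)|
      ≤ 2 * B * Real.exp (-((θ - θ₂) * R)) := by
  have h := abs_fourPt_log_det_le_of_summedProfiles_Icc dist hMc hM hM'c hne hα hε hδ hβ₀ hθ₂ hθ₂θ hSdist0 hD hE hsep hA hB0 hSd hSdi hR
  have he : 0 ≤ Real.exp (-((θ - θ₂) * R)) := (Real.exp_pos _).le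
  calc |Real.log (M 0 0).det - Real.log (M 1 0).det - (Real.log (M 0 1).det - Real.log (M 1 1).det)|
      ≤ α * ε * β₀ * δ * Sd * Sdist * Real.exp (-((θ - θ₂) * R)) + β₀ * η := h
    _ ≤ B * Real.exp (-((θ - θ₂) * R)) + B * Real.exp (-((θ - θ₂) * R)) :=
        add_le_add (mul_le_mul_of_nonneg_right hprod he) hmix
    _ = 2 * B * Real.exp (-((θ - θ₂) * R)) := by ring

/-! ## §4 Docking edition: rows on an OPEN parameter set `I ⊇ [0,1]` (the shape of a moving-minimiser Hessian family) -/

/-- ★ **THE PRODUCT FORM FROM OPEN-SET DIFFERENTIABILITY ROWS**: if the entries of `M(·,t)` have derivatives `M′(s,t)` at every `s` of an open-or-not set `I ⊇ [0,1]`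
with `s ↦ M′(s,t) i j` continuous on `I` and `det M(s,t) ≠ 0` on `I`, then §3 applies (differentiability on `I` gives continuity on `[0,1]`); the localisation rows
are still asked on `[0,1]` only. [cite: Balaban1985Variational, Thm 1 (10) p. 279] [cite: GlimmJaffe1987, §18.2] -/
theorem abs_fourPt_log_det_le_of_productRows_of_subset (dist : n → n → ℕ) {M M' : ℝ → ℝ → Matrix n n ℝ} {I : Set ℝ}
    (hI : Icc (0 : ℝ) 1 ⊆ I)
    (hM : ∀ t, ∀ s ∈ I, ∀ i j, HasDerivAt (fun s => M s t i j) (M' s t i j) s)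
    (hM'c : ∀ t i j, ContinuousOn (fun s => M' s t i j) I)
    (hne : ∀ s ∈ I, ∀ t, (M s t).det ≠ 0)
    {α ε δ β₀ η θ θ₂ Sd Sdist B : ℝ} (hα : 0 ≤ α) (hε : 0 ≤ ε) (hδ : 0 ≤ δ) (hβ₀ : 0 ≤ β₀)
    (hθ₂ : 0 ≤ θ₂) (hθ₂θ : θ₂ ≤ θ) (hSdist0 : 0 ≤ Sdist)
    {d d' : n → ℕ} (hD : ∀ s ∈ Icc (0 : ℝ) 1, ∀ a, ∑ x, |M' s 1 x a| ≤ δ * Real.exp (-(θ * d a)))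
    (hE : ∀ s ∈ Icc (0 : ℝ) 1, ∀ b, ∑ c, |(M s 1 - M s 0) b c| ≤ ε * Real.exp (-(θ * d' b)))
    {R : ℕ} (hsep : ∀ a b, R ≤ d a + dist a b + d' b)
    (hA : ∀ s ∈ Icc (0 : ℝ) 1, ∀ a b, |(M s 1)⁻¹ a b| ≤ α * Real.exp (-(θ * dist a b)))
    (hB0 : ∀ s ∈ Icc (0 : ℝ) 1, ∀ a b, |(M s 0)⁻¹ a b| ≤ β₀)
    (hSd : ∑ a, Real.exp (-(θ₂ * d a)) ≤ Sd) (hSdi : ∀ a, ∑ b, Real.exp (-(θ₂ * dist a b)) ≤ Sdist)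
    (hR : ∀ s ∈ Icc (0 : ℝ) 1, ∑ a, ∑ b, |(M' s 1 - M' s 0) a b| ≤ η)
    (hprod : α * ε * β₀ * δ * Sd * Sdist ≤ B) (hmix : β₀ * η ≤ B * Real.exp (-((θ - θ₂) * R))) :
    |Real.log (M 0 0).det - Real.log (M 1 0).det - (Real.log (M 0 1).det - Real.log (M 1 1).det)|
      ≤ 2 * B * Real.exp (-((θ - θ₂) * R)) := by
  have hMc : ∀ t i j, ContinuousOn (fun s => M s t i j) (Icc 0 1) := fun t i j s hs =>
    ((hM t s (hI hs) i j).continuousAt).continuousWithinAt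
  exact abs_fourPt_log_det_le_of_productRows_Icc dist hMc (fun t s hs i j => hM t s (hI (Ioo_subset_Icc_self hs)) i j)
    (fun t i j => (hM'c t i j).mono hI) (fun s hs t => hne s (hI hs) t) hα hε hδ hβ₀ hθ₂ hθ₂θ hSdist0 hD hE hsep hA hB0 hSd hSdi hR hprod hmix

end Literature.Analysis.Matrix

end
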